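import Summits.QuantumFields.YangMills.Theorems.BalabanUVNodesN16AtRRec12OfRecord

/-!
# YM-DAG node N21 (= NE7c): THE END's LETTERS AT THE NE3 OBJECT OF RECORD, TUNED FOR N21's ROAD I — `endLettersN21 F N g Λ₂' : Node00.NE3Letters₁₁` with the
# regularity letter `b⋆ := min (r∕2) (1∕(512·5·8·L²))` INSIDE THE END's tolerance `0 ≤ b ≤ ε∕2` (`r = radiusOfRecord N F.L (ne3NperOfRecord₁₁ F 0 0)`), so that THE
# END's proviso `InEndRegime` AND N21's regularity numeral `512·5·8·L²·b ≤ 1` hold at node00-def-RR-1's constant layer of record `ne3ConstLayerOfRecord₁₁ F N ·` together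

Track A of `YM-PLAN.md` (cell `pub-ymgap`, HUMAN RULING D-0062), node **N21**; R134 fan-out seat `pub-ymgap-dag-n21-d` (s2 = BY-NAME KNIT at the record), generation 3,
module 11a — the one definition module 11b (`BalabanUVNodesN21AtReadingOfRecord12`, theorems only) reads.  Definition lane: ONE `def` + `rfl` faces + three kernel facts;
0 `sorry`, no `instance`, no `notation`, standard axioms; COUNT-NEUTRAL; `--supports` the K3′ item `SpineGivenEndpointR12` (rev 15, stmt-QuantumFields-19908) as a helper.
Imports dag-n16-e's `BalabanUVNodesN16AtRRec12OfRecord` (THE END's CHOSEN thresholds `radiusOfRecord` ∕ `constOfRecord` of `…N16RegimeDefs`, `radiusOfRecord_pos`, the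
canonical letters `⟨r, r∕2, g, Cof g, r, Λ₂'⟩` of `inEndRegime_ofRecord_canonical` — NOT re-declared here) and, through it, node00-def-RR-1's `Node00/RateRecord11NE3Data`
(`NE3Letters₁₁`, `ne3ConstLayerOfRecord₁₁`, `ne3NperOfRecord₁₁`, `one_le_ne3NperOfRecord₁₁`).  `N`-generic, NO Theses import (restate-immune).

WHY.  N21's road I at explicit carriers (modules 5–10 of this lineage: `…N21AtKeyedRateHome{,U2,Const}`, `…N21AtRRec12{,ConstLayer}`) carries, next to THE END's proviso
`InEndRegime` at the NE3 layer, the REGULARITY NUMERAL `512·(4+1)·(4+4)·L²·b ≤ 1` (n21-a's closeness junction, `T4AveragingDeficitWall`) on the regularity letter `b`.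
dag-n16-e's canonical letters put `b = r∕2` with `r` THE END's chosen radius, for which no upper bound is available; but THE END's regime tolerates EVERY `b ∈ [0, ε∕2]`
(`…N16RegimeDefs.InEndRegime`: `0 ≤ c.b ∧ c.b ≤ c.ε ∕ 2`), so the letter can be TUNED: `b⋆ = min (r∕2) (1∕(512·5·8·L²))` — positive (not the degenerate `b = 0`), inside
the tolerance, and small enough for the numeral.  The other letters are n16-e's canonical ones: `ε = Λ₁ = r`, coupling letter `g`, constant `constOfRecord … g`, `Λ₂'` free.

WHAT IS DECLARED ∕ PROVED ([folklore]).
* `endLettersN21 F N g Λ₂'` (the tuned letters) with `rfl` faces `endLettersN21_ε ∕ _b ∕ _g ∕ _C ∕ _Λ₁ ∕ _Λ₂'`.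
* `endLettersN21_b_pos` (`0 < g`-free: `2 ≤ L`, `1 ≤ Nper` give `r > 0`), `endLettersN21_b_le_half` (`b⋆ ≤ r∕2`), `numeral_endLettersN21` (`512·(4+1)·(4+4)·L²·b⋆ ≤ 1`).
* `inEndRegime_ofRecord_endLettersN21` — for `0 < g`: `InEndRegime (ne3OfRecord₁₁ F (ne3ConstLayerOfRecord₁₁ F N (endLettersN21 F N g Λ₂')))`.
* `inEndRegime_and_numerals_endLettersN21` — for `0 < g`, `0 < Λ₂'`: the proviso AND both of N21's numerals at the tuned object (what module 10's `hreg` ∕ `hnum` ask).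

HONEST FRAMING (binding).  A CHOICE OF LETTERS inside THE END's displayed tolerance — it asserts nothing of Bałaban's and proves no estimate: N16's record decl `N16At` at the
tuned object (the in-edge's CONTENT, `LeafSlot` ∕ `PrintSlot` in n16-e's currency) and every N21 binder other than the proviso and the numerals stay HYPOTHESES of the consumers;
`radiusOfRecord` ∕ `constOfRecord` are n16-e's `Classical.choose` thresholds; **N21 NOT discharged**, N16 NOT discharged; typed 28∕28, discharged count untouched; one finite
four-torus programme at fixed `ε` — NOT ℝ⁴, NOT infinite volume, NOT OS, NOT a mass gap, NOT Clay.  No decl below carries a cite tag.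
v1.1 (generation 4, APPEND-ONLY: every v1.0 declaration above byte-identical) — THE WINDOWED LETTERS `endLettersN21W F N g ε Λ₁ Λ₂'`.  dag-n16-e g4's located item
«ε PINNED AT THE TOP OF THE TOLERANCE» (pub-ymgap INBOX DAGN16E-G4-LOCATED-3, 2026-08-27): `endLettersN21` pins the class radius `ε` AND `Λ₁` at THE END's chosen radius `r`
(an opaque `Classical.choose` threshold; only `0 < r` is knowable), while N16's slot hypothesis `LeafSlot c` at the same bundle carries [B8]-Thm-4's averaging-window lines
forcing `c.ε < c2' 4 c.L ∕ 2 ∧ c.ε < 1∕1056` (and `177·B·α ≤ c.Λ₁` with `c.ε < α`) — so the joint N16∕N21 line at `ε = Λ₁ = r` (module 11b §3 `…_tuned_of_leafSlot`) is kernel-fine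
but NOT CERTIFIABLY INHABITABLE.  THE END's regime tolerates EVERY `0 < ε ≤ r`, `0 ≤ Λ₁ ≤ r` (`InEndRegime`), so the cure on N21's side is ONE letter: the same tuned
regularity letter `b⋆ := min (ε∕2) (1∕(512·5·8·L²))` at a WINDOWED class radius `ε ∈ (0, r]` with `Λ₁ ∈ [0, r]` decoupled from `ε` — `endLettersN21W` below, with
`inEndRegime_ofRecord_endLettersN21W`, `numeral_endLettersN21W`, and `endLettersN21W_top` (`ε = Λ₁ = r` recovers `endLettersN21`: the v1.0 letters are the top corner of the
window).  n16-e's window recipe (`…N16SlotWindow.leafSlot_ofRecord_of_window`, their INTENT-11) supplies `LeafSlot` at such letters for `ε` inside N05's averaging window;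
module 11b v1.1 reads the composite at `endLettersN21W`.  Still a CHOICE OF LETTERS — nothing of Bałaban's asserted, N21 ∕ N16 NOT discharged.
-/

set_option autoImplicit false

noncomputable section

namespace Summit.QuantumFields.YangMills.BalabanUVNodes.N21EndLetters

open Literature.MathematicalPhysics.QuantumFieldTheory.Balaban1983to89
open Literature.MathematicalPhysics.QuantumFieldTheory.Balaban1983to89.T4Continuum (T4Family)
open Node00 (NE3Objects₁₁ NE3Letters₁₁ ne3ConstLayerOfRecord₁₁ ne3NperOfRecord₁₁ ne3DomOfRecord₁₁ one_le_ne3NperOfRecord₁₁)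
open Summit.QuantumFields.BalabanUV.T4Continuum
open YMDAG.UVSplit (ne3OfRecord₁₁)
open Summit.QuantumFields.YangMills.BalabanUVNodes.N16Regime (InEndRegime radiusOfRecord constOfRecord radiusOfRecord_pos)
open Summit.QuantumFields.YangMills.BalabanUVNodes.N16AtKeyedHome (inEndRegime_ne3OfRecord₁₁_canonical)
open Summit.QuantumFields.YangMills.BalabanUVNodes.N16AtRateRecord11 (inEndRegime_ne3Objects_iff)

variable (F : T4Family) (N : ℕ) [NeZero N]

/-- **THE END's LETTERS AT THE OBJECT OF RECORD, TUNED FOR N21** — `⟨ε, b, g, C, Λ₁, Λ₂'⟩ := ⟨r, min (r∕2) (1∕(512·(4+1)·(4+4)·L²)), g, constOfRecord N L Nper g, r, Λ₂'⟩`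
with `r = radiusOfRecord N F.L (ne3NperOfRecord₁₁ F 0 0)` (THE END's chosen radius at the physical unit torus `Nper = 2·L^m`): dag-n16-e's canonical letters with the
regularity letter lowered inside THE END's tolerance `0 ≤ b ≤ ε∕2` until N21's numeral `512·5·8·L²·b ≤ 1` holds. [folklore] -/
def endLettersN21 (g Λ₂' : ℝ) : NE3Letters₁₁ :=
  ⟨radiusOfRecord N F.L (ne3NperOfRecord₁₁ F 0 0),
    min (radiusOfRecord N F.L (ne3NperOfRecord₁₁ F 0 0) / 2) (1 / (512 * (4 + 1) * (4 + 4) * (F.L : ℝ) ^ 2)), g,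
    constOfRecord N F.L (ne3NperOfRecord₁₁ F 0 0) g, radiusOfRecord N F.L (ne3NperOfRecord₁₁ F 0 0), Λ₂'⟩

variable (g Λ₂' : ℝ)

/-- Face (`rfl`): `ε = r`. [folklore] -/
theorem endLettersN21_ε : (endLettersN21 F N g Λ₂').ε = radiusOfRecord N F.L (ne3NperOfRecord₁₁ F 0 0) := rfl

/-- Face (`rfl`): `b = min (r∕2) (1∕(512·5·8·L²))`. [folklore] -/
theorem endLettersN21_b : (endLettersN21 F N g Λ₂').b =
    min (radiusOfRecord N F.L (ne3NperOfRecord₁₁ F 0 0) / 2) (1 / (512 * (4 + 1) * (4 + 4) * (F.L : ℝ) ^ 2)) := rfl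

/-- Face (`rfl`): the coupling letter. [folklore] -/
theorem endLettersN21_g : (endLettersN21 F N g Λ₂').g = g := rfl

/-- Face (`rfl`): `C = constOfRecord N L Nper g`. [folklore] -/
theorem endLettersN21_C : (endLettersN21 F N g Λ₂').C = constOfRecord N F.L (ne3NperOfRecord₁₁ F 0 0) g := rfl

/-- Face (`rfl`): `Λ₁ = r`. [folklore] -/
theorem endLettersN21_Λ₁ : (endLettersN21 F N g Λ₂').Λ₁ = radiusOfRecord N F.L (ne3NperOfRecord₁₁ F 0 0) := rfl

/-- Face (`rfl`): `Λ₂'` is the caller's. [folklore] -/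
theorem endLettersN21_Λ₂' : (endLettersN21 F N g Λ₂').Λ₂' = Λ₂' := rfl

/-- **THE TUNED REGULARITY LETTER IS POSITIVE** (`r > 0` from `2 ≤ L`, `1 ≤ Nper`: n16-e's `radiusOfRecord_pos`). [folklore] -/
theorem endLettersN21_b_pos : 0 < (endLettersN21 F N g Λ₂').b := by
  have hr : 0 < radiusOfRecord N F.L (ne3NperOfRecord₁₁ F 0 0) := radiusOfRecord_pos (HistoryFlow.two_le_L F) (one_le_ne3NperOfRecord₁₁ F 0 0)
  have hL : 0 < (F.L : ℝ) := by have := HistoryFlow.two_le_L F; positivity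
  rw [endLettersN21_b]
  exact lt_min (by positivity) (by positivity)

/-- The tuned regularity letter is inside THE END's tolerance: `b ≤ r∕2 = ε∕2`. [folklore] -/
theorem endLettersN21_b_le_half : (endLettersN21 F N g Λ₂').b ≤ radiusOfRecord N F.L (ne3NperOfRecord₁₁ F 0 0) / 2 :=
  min_le_left _ _

/-- **N21's REGULARITY NUMERAL AT THE TUNED LETTERS**: `512·(4+1)·(4+4)·L²·b ≤ 1`. [folklore] -/
theorem numeral_endLettersN21 : 512 * (4 + 1) * (4 + 4) * (F.L : ℝ) ^ 2 * (endLettersN21 F N g Λ₂').b ≤ 1 := by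
  have hL : 0 < (F.L : ℝ) := by have := HistoryFlow.two_le_L F; positivity
  have hK : 0 < 512 * (4 + 1) * (4 + 4) * (F.L : ℝ) ^ 2 := by positivity
  calc 512 * (4 + 1) * (4 + 4) * (F.L : ℝ) ^ 2 * (endLettersN21 F N g Λ₂').b
      ≤ 512 * (4 + 1) * (4 + 4) * (F.L : ℝ) ^ 2 * (1 / (512 * (4 + 1) * (4 + 4) * (F.L : ℝ) ^ 2)) :=
        mul_le_mul_of_nonneg_left (min_le_right _ _) hK.le
    _ = 1 := by field_simp

variable {g}

/-- **THE END's PROVISO AT THE TUNED OBJECT OF RECORD**: for a positive coupling letter, `InEndRegime (ne3OfRecord₁₁ F (ne3ConstLayerOfRecord₁₁ F N (endLettersN21 F N g Λ₂')))`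
— `1 ≤ Nper` is RR-1's `one_le_ne3NperOfRecord₁₁`, `r > 0` n16-e's `radiusOfRecord_pos`, and `0 ≤ b⋆ ≤ ε∕2` by construction. [folklore] -/
theorem inEndRegime_ofRecord_endLettersN21 (hg : 0 < g) :
    InEndRegime (ne3OfRecord₁₁ F (ne3ConstLayerOfRecord₁₁ F N (endLettersN21 F N g Λ₂'))) := by
  have hr : 0 < radiusOfRecord N F.L (ne3NperOfRecord₁₁ F 0 0) := radiusOfRecord_pos (HistoryFlow.two_le_L F) (one_le_ne3NperOfRecord₁₁ F 0 0)
  exact (inEndRegime_ne3Objects_iff F _).2 ⟨one_le_ne3NperOfRecord₁₁ F 0 0, hg, hr, le_rfl, hr.le, le_rfl, (endLettersN21_b_pos F N g Λ₂').le,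
    endLettersN21_b_le_half F N g Λ₂', le_rfl⟩

/-- **THE PROVISO AND N21's TWO NUMERALS AT THE TUNED OBJECT, TOGETHER** (what module 10's binders `hreg`, `hnum` ask of the layer): for `0 < g`, `0 < Λ₂'`. [folklore] -/
theorem inEndRegime_and_numerals_endLettersN21 (hg : 0 < g) {Λ₂' : ℝ} (hΛ : 0 < Λ₂') :
    InEndRegime (ne3OfRecord₁₁ F (ne3ConstLayerOfRecord₁₁ F N (endLettersN21 F N g Λ₂'))) ∧
      512 * (4 + 1) * (4 + 4) * (F.L : ℝ) ^ 2 * (ne3ConstLayerOfRecord₁₁ F N (endLettersN21 F N g Λ₂')).b ≤ 1 ∧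
      0 < (ne3ConstLayerOfRecord₁₁ F N (endLettersN21 F N g Λ₂')).Λ₂' :=
  ⟨inEndRegime_ofRecord_endLettersN21 F N Λ₂' hg, numeral_endLettersN21 F N g Λ₂', hΛ⟩

/-! ## v1.1 — THE WINDOWED LETTERS: class radius `ε ∈ (0, r]` and `Λ₁ ∈ [0, r]` free, the regularity letter tuned at `ε` -/

section Window

/-- **THE END's LETTERS AT THE OBJECT OF RECORD, WINDOWED AND TUNED FOR N21** — `⟨ε, b, g, C, Λ₁, Λ₂'⟩ := ⟨ε, min (ε∕2) (1∕(512·(4+1)·(4+4)·L²)), g, constOfRecord N L Nper g,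
Λ₁, Λ₂'⟩` (`Nper = ne3NperOfRecord₁₁ F 0 0`): the class radius `ε` and the gradient letter `Λ₁` are the CALLER's (to be taken inside THE END's tolerance `(0, r]` ∕ `[0, r]` AND
inside node N05's averaging window — dag-n16-e's LOCATED-3), the regularity letter is lowered inside `0 ≤ b ≤ ε∕2` until N21's numeral `512·5·8·L²·b ≤ 1` holds. [folklore] -/
def endLettersN21W (g ε Λ₁ Λ₂' : ℝ) : NE3Letters₁₁ :=
  ⟨ε, min (ε / 2) (1 / (512 * (4 + 1) * (4 + 4) * (F.L : ℝ) ^ 2)), g, constOfRecord N F.L (ne3NperOfRecord₁₁ F 0 0) g, Λ₁, Λ₂'⟩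

/-- Face (`rfl`): `ε` is the caller's. [folklore] -/
theorem endLettersN21W_ε (g ε Λ₁ Λ₂' : ℝ) : (endLettersN21W F N g ε Λ₁ Λ₂').ε = ε := rfl

/-- Face (`rfl`): `b = min (ε∕2) (1∕(512·5·8·L²))`. [folklore] -/
theorem endLettersN21W_b (g ε Λ₁ Λ₂' : ℝ) :
    (endLettersN21W F N g ε Λ₁ Λ₂').b = min (ε / 2) (1 / (512 * (4 + 1) * (4 + 4) * (F.L : ℝ) ^ 2)) := rfl

/-- Face (`rfl`): the coupling letter. [folklore] -/
theorem endLettersN21W_g (g ε Λ₁ Λ₂' : ℝ) : (endLettersN21W F N g ε Λ₁ Λ₂').g = g := rfl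

/-- Face (`rfl`): `C = constOfRecord N L Nper g`. [folklore] -/
theorem endLettersN21W_C (g ε Λ₁ Λ₂' : ℝ) : (endLettersN21W F N g ε Λ₁ Λ₂').C = constOfRecord N F.L (ne3NperOfRecord₁₁ F 0 0) g := rfl

/-- Face (`rfl`): `Λ₁` is the caller's (decoupled from `ε`). [folklore] -/
theorem endLettersN21W_Λ₁ (g ε Λ₁ Λ₂' : ℝ) : (endLettersN21W F N g ε Λ₁ Λ₂').Λ₁ = Λ₁ := rfl

/-- Face (`rfl`): `Λ₂'` is the caller's. [folklore] -/
theorem endLettersN21W_Λ₂' (g ε Λ₁ Λ₂' : ℝ) : (endLettersN21W F N g ε Λ₁ Λ₂').Λ₂' = Λ₂' := rfl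

/-- **THE v1.0 LETTERS ARE THE TOP CORNER OF THE WINDOW**: at `ε = Λ₁ = r` the windowed letters are `endLettersN21 F N g Λ₂'` (`rfl`). [folklore] -/
theorem endLettersN21W_top (g Λ₂' : ℝ) :
    endLettersN21W F N g (radiusOfRecord N F.L (ne3NperOfRecord₁₁ F 0 0)) (radiusOfRecord N F.L (ne3NperOfRecord₁₁ F 0 0)) Λ₂' = endLettersN21 F N g Λ₂' := rfl

/-- The tuned regularity letter is positive for a positive class radius. [folklore] -/
theorem endLettersN21W_b_pos (g Λ₁ Λ₂' : ℝ) {ε : ℝ} (hε : 0 < ε) : 0 < (endLettersN21W F N g ε Λ₁ Λ₂').b := by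
  have hL : 0 < (F.L : ℝ) := by have := HistoryFlow.two_le_L F; positivity
  rw [endLettersN21W_b]
  exact lt_min (by positivity) (by positivity)

/-- The tuned regularity letter is inside THE END's tolerance: `b ≤ ε∕2`. [folklore] -/
theorem endLettersN21W_b_le_half (g ε Λ₁ Λ₂' : ℝ) : (endLettersN21W F N g ε Λ₁ Λ₂').b ≤ ε / 2 :=
  min_le_left _ _

/-- **N21's REGULARITY NUMERAL AT THE WINDOWED LETTERS**: `512·(4+1)·(4+4)·L²·b ≤ 1` (any `ε`). [folklore] -/
theorem numeral_endLettersN21W (g ε Λ₁ Λ₂' : ℝ) : 512 * (4 + 1) * (4 + 4) * (F.L : ℝ) ^ 2 * (endLettersN21W F N g ε Λ₁ Λ₂').b ≤ 1 := by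
  have hL : 0 < (F.L : ℝ) := by have := HistoryFlow.two_le_L F; positivity
  have hK : 0 < 512 * (4 + 1) * (4 + 4) * (F.L : ℝ) ^ 2 := by positivity
  calc 512 * (4 + 1) * (4 + 4) * (F.L : ℝ) ^ 2 * (endLettersN21W F N g ε Λ₁ Λ₂').b
      ≤ 512 * (4 + 1) * (4 + 4) * (F.L : ℝ) ^ 2 * (1 / (512 * (4 + 1) * (4 + 4) * (F.L : ℝ) ^ 2)) :=
        mul_le_mul_of_nonneg_left (min_le_right _ _) hK.le
    _ = 1 := by field_simp

/-- **THE END's PROVISO AT THE WINDOWED OBJECT OF RECORD**: for a positive coupling letter, a class radius `0 < ε ≤ r` and a gradient letter `0 ≤ Λ₁ ≤ r`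
(`r = radiusOfRecord N F.L (ne3NperOfRecord₁₁ F 0 0)`), `InEndRegime (ne3OfRecord₁₁ F (ne3ConstLayerOfRecord₁₁ F N (endLettersN21W F N g ε Λ₁ Λ₂')))` — every other clause by
construction (`1 ≤ Nper` RR-1's, `0 ≤ b⋆ ≤ ε∕2`, `C = constOfRecord … g`). [folklore] -/
theorem inEndRegime_ofRecord_endLettersN21W (Λ₂' : ℝ) {g ε Λ₁ : ℝ} (hg : 0 < g) (hε : 0 < ε)
    (hεr : ε ≤ radiusOfRecord N F.L (ne3NperOfRecord₁₁ F 0 0)) (hΛ₁ : 0 ≤ Λ₁) (hΛ₁r : Λ₁ ≤ radiusOfRecord N F.L (ne3NperOfRecord₁₁ F 0 0)) :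
    InEndRegime (ne3OfRecord₁₁ F (ne3ConstLayerOfRecord₁₁ F N (endLettersN21W F N g ε Λ₁ Λ₂'))) :=
  (inEndRegime_ne3Objects_iff F _).2 ⟨one_le_ne3NperOfRecord₁₁ F 0 0, hg, hε, hεr, hΛ₁, hΛ₁r, (endLettersN21W_b_pos F N g Λ₁ Λ₂' hε).le,
    endLettersN21W_b_le_half F N g ε Λ₁ Λ₂', le_rfl⟩

/-- **THE PROVISO AND N21's TWO NUMERALS AT THE WINDOWED OBJECT, TOGETHER** (what module 10's binders `hreg`, `hnum` and module 11b §1's `hreg`, `hnum` ask of the layer):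
for `0 < g`, `0 < ε ≤ r`, `0 ≤ Λ₁ ≤ r`, `0 < Λ₂'`. [folklore] -/
theorem inEndRegime_and_numerals_endLettersN21W {g ε Λ₁ Λ₂' : ℝ} (hg : 0 < g) (hε : 0 < ε)
    (hεr : ε ≤ radiusOfRecord N F.L (ne3NperOfRecord₁₁ F 0 0)) (hΛ₁ : 0 ≤ Λ₁) (hΛ₁r : Λ₁ ≤ radiusOfRecord N F.L (ne3NperOfRecord₁₁ F 0 0))
    (hΛ : 0 < Λ₂') :
    InEndRegime (ne3OfRecord₁₁ F (ne3ConstLayerOfRecord₁₁ F N (endLettersN21W F N g ε Λ₁ Λ₂'))) ∧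
      512 * (4 + 1) * (4 + 4) * (F.L : ℝ) ^ 2 * (ne3ConstLayerOfRecord₁₁ F N (endLettersN21W F N g ε Λ₁ Λ₂')).b ≤ 1 ∧
      0 < (ne3ConstLayerOfRecord₁₁ F N (endLettersN21W F N g ε Λ₁ Λ₂')).Λ₂' :=
  ⟨inEndRegime_ofRecord_endLettersN21W F N Λ₂' hg hε hεr hΛ₁ hΛ₁r, numeral_endLettersN21W F N g ε Λ₁ Λ₂', hΛ⟩

/-- **THE WINDOW IS INHABITED INSIDE THE TOLERANCE**: for every `0 < ε⋆` there is a class radius `ε ∈ (0, r]` with `ε < ε⋆` (take `min (r∕2) (ε⋆∕2)`) — so ANY strict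
upper bound a consumer's slot hypothesis puts on the class radius (n16-e's certificate `c.ε < c2' 4 c.L ∕ 2 ∧ c.ε < 1∕1056`, or N05's averaging letter `α`) is met by
SOME windowed letters in THE END's regime, unlike at the pinned `ε = r`. [folklore] -/
theorem exists_eps_window {εstar : ℝ} (hε : 0 < εstar) :
    ∃ ε : ℝ, 0 < ε ∧ ε ≤ radiusOfRecord N F.L (ne3NperOfRecord₁₁ F 0 0) ∧ ε < εstar := by
  have hr : 0 < radiusOfRecord N F.L (ne3NperOfRecord₁₁ F 0 0) :=
    radiusOfRecord_pos (HistoryFlow.two_le_L F) (one_le_ne3NperOfRecord₁₁ F 0 0)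
  refine ⟨min (radiusOfRecord N F.L (ne3NperOfRecord₁₁ F 0 0) / 2) (εstar / 2), lt_min (by positivity) (by positivity),
    (min_le_left _ _).trans (by linarith), (min_le_right _ _).trans_lt (by linarith)⟩

end Window

end Summit.QuantumFields.YangMills.BalabanUVNodes.N21EndLetters

end
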